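import Mathlib
import HarnessLib
import Literature.Geometry.DiscreteGeometry.KissingPatterns
import Literature.Geometry.DiscreteGeometry.FlyspeckL12
import Literature.Geometry.DiscreteGeometry.FejesTothKissingTwelve
import Summits.AtomisticToContinuum.Crystallization.Theorems.ContactSaturationLadderQuasiTwelve
import Summits.AtomisticToContinuum.Crystallization.Theses.ContactSaturationLadder

/-!
# Local quasi-twelve rigidity from Flyspeck (part 2 of 2; part 1 = `ContactSaturationLadderQuasiTwelve.lean`, §A–§C) — the registered stub `stub_rigidityFromFlyspeck` of
# `TightSomewhereRung` (route ContactSaturationLadder, item stmt-AtomisticToContinuum-30305), PROVED;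
# hence `T = TightSomewhereRung` from the two vendored named facts

Route `route-AtomisticToContinuum-ContactSaturationLadder` (decomposition cell decomp-a2c, lens-1 «grading /
quantitative ladder», g5) cut the parent's residual `WellBonded` into `T ∧ B ∧ C`; `T` (support, EXPECTED
VACUOUS, ATTACKABLE NOW) is the class of well-bonded Lennard-Jones ground-state sequences that FREQUENTLY contain a
uniformly δ-tight 5-ball.  Its registered BC3 skeleton (`TightSomewhereRung_birth.lean`, stubs `stub_flyspeckFacts`
[cite] and `stub_rigidityFromFlyspeck` [L]) composes `T` from the two NAMED FACTS
`Literature.Geometry.DiscreteGeometry.flyspeck_L12` (Flyspeck lemma L12, HOL-Light verified) and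
`Literature.Geometry.DiscreteGeometry.Hales2012_kissingConfigCongruent` (Hales 2012, Thm 1: a kissing configuration
whose pair distances are `2` or `≥ 2.52` is cuboctahedral or anticuboctahedral) through the DOOR

  `LocalQuasiTwelveRigidity : ∃ δ₀ > 0, every particle within 2 of the centre of a uniformly δ₀-tight 5-ball is 1/100-good`.

This file proves the [L] stub `flyspeck_L12 → Hales2012_kissingConfigCongruent → LocalQuasiTwelveRigidity` with its
REGISTERED signature (`stub_rigidityFromFlyspeck` below, skeleton v2 `TightSomewhereRung_line_v2.lean` of item 30305; the route's
predicates `Good` / `UniformlyTight` are kept INLINE exactly as the tree states them — definition-free file), and composes it exactly as the skeleton does into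
`tightSomewhereRung_of_facts : flyspeck_L12 → Hales2012_kissingConfigCongruent → ContactSaturationLadder.TightSomewhereRung`
(the tree item BY NAME; conditional only on the two cited facts, axioms `propext, Classical.choice, Quot.sound`).

## The proof = a three-rung δ-ladder of Hales's Fejes Tóth theorem made LOCAL (paper: Hales, *Dense Sphere Packings*
(2012) §6 / arXiv:1209.6043 Lemmas 9–10; here from the vendored statements only)

* RUNG G (EFFECTIVE, δ < 1/50) `ContactSaturationLadderQuasiTwelve.twelve_gap`: if `y v` has ≥ 12 other points within `(1+δ)d` and all pairs
  within `1.26·d` of `y v` are `≥ d` apart, then it has EXACTLY twelve, and every other point is either within `(1+δ)d`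
  or beyond `(1.26 − 12δ)·d` — rescale by `2/d`, apply `L12` (`∑ L(h) ≤ 12`, `L` affine, `L(1)=1`, `L(1.26)=0`) to the
  twelve near points plus the intruder.
* RUNG P (INEFFECTIVE, compactness) `ContactSaturationLadderQuasiTwelve.kissing_compactness`: for every ε > 0 there is δ₁ > 0 such that every
  δ₁-quasi-kissing twelve-tuple (norms in `[2, 2+2δ]`, pair distances `≥ 2` and in `[2, 2+2δ] ∪ [2.52 − 24δ, ∞)`) is
  ε-close, index by index, to an injective tuple whose range is a kissing configuration in Hales's class — Bolzano–
  Weierstrass in `Fin 12 → ℝ³` on a sequence of counterexamples, the limit is a genuine kissing configuration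
  (`ContactSaturationLadderQuasiTwelve.kissing_of_limit`).
* ASSEMBLY `rigidityFromFlyspeck_holds` (δ₀ := min δ₁(1/60) 1/2000, matching scale a := d, axial parameter t := 0):
  around a particle `k` within 2 of the centre, rung G (at `k` and at each of its twelve near points, all within 7/2 of
  the centre where uniform tightness still gives twelve-coordination) makes the rescaled near tuple δ-quasi-kissing; rung
  P and Hales's congruence theorem put it within 1/60 of `2·A(P)`, `P ∈ {fcc, hcp}` kissing pattern, `A` a linear
  isometry; the annular gap gives «5d/4-shell of k = the twelve near points» (no covering-angle step is needed:
  `5/4 < 1.26 − 12δ₀`), and scaling back by `d/2 ≤ 3/5` yields the `1/100`-matching `Good (1/100) y k`.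
RUNG E (an EFFECTIVE δ₀, via the slack in Hales's linear programs) is not needed for `T` and is left to instruments.
-/

open scoped BigOperators Topology
open Filter
open Literature.Geometry.DiscreteGeometry

namespace Summit.AtomisticToContinuum.Crystallization.Theorems.ContactSaturationLadderTightSomewhereRungRigidity

open Summit.AtomisticToContinuum.Crystallization.Theorems.ContactSaturationLadderQuasiTwelve

/-! ## §D  Rung G inside a uniformly tight 5-ball (the route's predicates are kept INLINE — definition-free file) -/

/-- Inside a uniformly δ-tight 5-ball, every particle within 7/2 of the centre satisfies the
hypotheses of `twelve_gap`. -/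
theorem gap_at {δ d : ℝ} {N : ℕ} {y : Fin N → EuclideanSpace ℝ (Fin 3)} {j : Fin N}
    (hL12 : flyspeck_L12)
    (hT : (3 / 4 ≤ d ∧ d ≤ 6 / 5 ∧ (∀ k l : Fin N, k ≠ l → dist (y k) (y j) ≤ 6 → dist (y l) (y j) ≤ 6 → d ≤ dist (y k) (y l)) ∧ (∀ k : Fin N, dist (y k) (y j) ≤ 5 → 12 ≤ (Finset.univ.filter fun l => l ≠ k ∧ dist (y l) (y k) ≤ (1 + δ) * d).card)))
    (hδ0 : 0 ≤ δ) (hδ : δ < 1 / 50)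
    {v : Fin N} (hv : dist (y v) (y j) ≤ 7 / 2) :
    (Finset.univ.filter fun l => l ≠ v ∧ dist (y l) (y v) ≤ (1 + δ) * d).card = 12 ∧
      ∀ w : Fin N, w ≠ v → dist (y w) (y v) ≤ (1 + δ) * d ∨
        (63 / 50 - 12 * δ) * d ≤ dist (y w) (y v) := by
  obtain ⟨hd1, hd2, hsep, hcoord⟩ := hT
  have hd : 0 < d := by linarith
  refine twelve_gap hL12 y v hd hδ0 hδ ?_ ?_
  · intro k l hkl hk hl
    refine hsep k l hkl ?_ ?_
    · calc dist (y k) (y j) ≤ dist (y k) (y v) + dist (y v) (y j) := dist_triangle _ _ _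
        _ ≤ 63 / 50 * d + 7 / 2 := by linarith
        _ ≤ 6 := by nlinarith
    · calc dist (y l) (y j) ≤ dist (y l) (y v) + dist (y v) (y j) := dist_triangle _ _ _
        _ ≤ 63 / 50 * d + 7 / 2 := by linarith
        _ ≤ 6 := by nlinarith
  · have := hcoord v (hv.trans (by norm_num))
    simpa using this


end Summit.AtomisticToContinuum.Crystallization.Theorems.ContactSaturationLadderTightSomewhereRungRigidity

namespace Summit.AtomisticToContinuum.Crystallization.Theorems.ContactSaturationLadderTightSomewhereRungRigidity

open Summit.AtomisticToContinuum.Crystallization.Theorems.ContactSaturationLadderQuasiTwelve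

/-! ## §E  The door of T, PROVED from the two vendored facts -/

/-- **Local quasi-twelve rigidity from Flyspeck** (the door of `T`; = the registered `stub_rigidityFromFlyspeck` of
item stmt-AtomisticToContinuum-30305): Hales's `L12` and the congruence theorem for kissing
configurations imply that every particle within 2 of the centre of a uniformly δ₀-tight 5-ball is
1/100-good, for some δ₀ > 0. -/
theorem stub_rigidityFromFlyspeck : Literature.Geometry.DiscreteGeometry.flyspeck_L12 → Literature.Geometry.DiscreteGeometry.Hales2012_kissingConfigCongruent → ∃ δ : ℝ, 0 < δ ∧ ∀ (N : ℕ) (y : Fin N → EuclideanSpace ℝ (Fin 3)) (j : Fin N) (d : ℝ), (3 / 4 ≤ d ∧ d ≤ 6 / 5 ∧ (∀ k l : Fin N, k ≠ l → dist (y k) (y j) ≤ 6 → dist (y l) (y j) ≤ 6 → d ≤ dist (y k) (y l)) ∧ (∀ k : Fin N, dist (y k) (y j) ≤ 5 → 12 ≤ (Finset.univ.filter fun l => l ≠ k ∧ dist (y l) (y k) ≤ (1 + δ) * d).card)) → ∀ k : Fin N, dist (y k) (y j) ≤ 2 → (∃ a t : ℝ, 3 / 4 ≤ a ∧ a ≤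 3 / 2 ∧ |t| ≤ 1 / 100 ∧ (Literature.Geometry.DiscreteGeometry.ShellCloseTo (1 / 100) ((Finset.univ.filter fun j => j ≠ k ∧ dist (y j) (y k) ≤ 5 * a / 4).image fun j => y j - y k) (Literature.Geometry.DiscreteGeometry.hcpKissingPattern.image fun u => a • (u + (t * (u 0 + u 1 + u 2) / 3) • Literature.Geometry.DiscreteGeometry.intVec ![1, 1, 1])) ∨ Literature.Geometry.DiscreteGeometry.ShellCloseTo (1 / 100) ((Finset.univ.filter fun j => j ≠ k ∧ dist (y j) (y k) ≤ 5 * a / 4).image fun j => y j - y k) (Literature.Geometry.DiscreteGeometry.fccKissingPattern.image fun u => a • (u + (t * (u 0 + u 1 + u 2) / 3) • Literature.Geometry.DiscreteGeometry.intVec ![1, 1, 1])))) := by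
  intro hL12 hcong
  obtain ⟨δ₁, hδ₁, hcomp⟩ := kissing_compactness (show (0 : ℝ) < 1 / 60 by norm_num)
  set δ : ℝ := min δ₁ (1 / 2000) with hδdef
  have hδpos : 0 < δ := lt_min hδ₁ (by norm_num)
  have hδ1 : δ ≤ δ₁ := min_le_left _ _
  have hδs : δ ≤ 1 / 2000 := min_le_right _ _
  refine ⟨δ, hδpos, ?_⟩
  intro N y j d hT k hk
  have hδ0 : 0 ≤ δ := hδpos.le
  have hδ50 : δ < 1 / 50 := by linarith
  have hT' := hT
  obtain ⟨hd1, hd2, hsep, hcoord⟩ := hT'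
  have hd : 0 < d := by linarith
  -- Rung G at the centre particle k
  obtain ⟨hcardk, hdichk⟩ := gap_at hL12 hT hδ0 hδ50 (hk.trans (by norm_num))
  -- enumerate the twelve near points of k
  let l : Fin 12 ↪o Fin N := ((Finset.univ.filter fun l => l ≠ k ∧ dist (y l) (y k) ≤ (1 + δ) * d)).orderEmbOfFin hcardk
  have hlS : ∀ i, l i ∈ (Finset.univ.filter fun l => l ≠ k ∧ dist (y l) (y k) ≤ (1 + δ) * d) := fun i =>
    ((Finset.univ.filter fun l => l ≠ k ∧ dist (y l) (y k) ≤ (1 + δ) * d)).orderEmbOfFin_mem hcardk i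
  have hlrange : Set.range l = ↑((Finset.univ.filter fun l => l ≠ k ∧ dist (y l) (y k) ≤ (1 + δ) * d)) :=
    ((Finset.univ.filter fun l => l ≠ k ∧ dist (y l) (y k) ≤ (1 + δ) * d)).range_orderEmbOfFin hcardk
  have hl : ∀ i, l i ≠ k ∧ dist (y (l i)) (y k) ≤ (1 + δ) * d := fun i =>
    mem_nearSet.1 (hlS i)
  have hlj : ∀ i, dist (y (l i)) (y j) ≤ 7 / 2 := by
    intro i
    calc dist (y (l i)) (y j) ≤ dist (y (l i)) (y k) + dist (y k) (y j) := dist_triangle _ _ _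
      _ ≤ (1 + δ) * d + 2 := by linarith [(hl i).2]
      _ ≤ 7 / 2 := by nlinarith
  have hl6 : ∀ i, dist (y (l i)) (y j) ≤ 6 := fun i => (hlj i).trans (by norm_num)
  have hk6 : dist (y k) (y j) ≤ 6 := hk.trans (by norm_num)
  -- the rescaled twelve-tuple around k (Hales's normalisation)
  set p : Fin 12 → EuclideanSpace ℝ (Fin 3) := fun i => (2 / d) • (y (l i) - y k) with hpdef
  have h2d : (0 : ℝ) < 2 / d := by positivity
  have hnp : ∀ i, ‖p i‖ = 2 / d * dist (y (l i)) (y k) := by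
    intro i
    simp only [hpdef, norm_smul, Real.norm_eq_abs, abs_of_pos h2d, dist_eq_norm]
  have hdp : ∀ i i', dist (p i) (p i') = 2 / d * dist (y (l i)) (y (l i')) := by
    intro i i'
    simp only [hpdef, dist_smul₀, Real.norm_eq_abs, abs_of_pos h2d]
    congr 1
    rw [dist_eq_norm, dist_eq_norm]
    congr 1
    abel
  have hQ : ((∀ i, 2 ≤ ‖p i‖ ∧ ‖p i‖ ≤ 2 + 2 * δ) ∧ ∀ i j, i ≠ j → 2 ≤ dist (p i) (p j) ∧ (dist (p i) (p j) ≤ 2 + 2 * δ ∨ 2 * hales_h0 - 24 * δ ≤ dist (p i) (p j))) := by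
    refine ⟨fun i => ?_, fun i i' hii' => ?_⟩
    · rw [hnp]
      obtain ⟨hik, hid⟩ := hl i
      have hdk := hsep (l i) k hik (hl6 i) hk6
      constructor
      · calc (2 : ℝ) = 2 / d * d := by field_simp
          _ ≤ 2 / d * dist (y (l i)) (y k) := by gcongr
      · calc 2 / d * dist (y (l i)) (y k) ≤ 2 / d * ((1 + δ) * d) := by gcongr
          _ = 2 + 2 * δ := by field_simp
    · have hne : l i ≠ l i' := fun h => hii' (l.injective h)
      rw [hdp]
      constructor
      · have := hsep (l i) (l i') hne (hl6 i) (hl6 i')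
        calc (2 : ℝ) = 2 / d * d := by field_simp
          _ ≤ 2 / d * dist (y (l i)) (y (l i')) := by gcongr
      · obtain ⟨-, hdich⟩ := gap_at hL12 hT hδ0 hδ50 (hlj i)
        rcases hdich (l i') hne.symm with h | h
        · left
          rw [dist_comm] at h
          calc 2 / d * dist (y (l i)) (y (l i')) ≤ 2 / d * ((1 + δ) * d) := by gcongr
            _ = 2 + 2 * δ := by field_simp
        · right
          rw [dist_comm] at h
          rw [hales_h0_val]
          calc 2 * (63 / 50 : ℝ) - 24 * δ = 2 / d * ((63 / 50 - 12 * δ) * d) := by field_simp; ring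
            _ ≤ 2 / d * dist (y (l i)) (y (l i')) := by gcongr
  -- Rung P (compactness) and Hales's congruence theorem
  obtain ⟨q, hqinj, hK, hclose⟩ := hcomp p (quasiKissing_mono hδ1 hQ)
  obtain ⟨P, hP, hPcard, A, hA⟩ : ∃ P : Finset (EuclideanSpace ℝ (Fin 3)),
      (P = hcpKissingPattern ∨ P = fccKissingPattern) ∧ P.card = 12 ∧
      ∃ A : EuclideanSpace ℝ (Fin 3) →ₗᵢ[ℝ] EuclideanSpace ℝ (Fin 3),
        Set.range q = (fun u => (2 : ℝ) • A u) '' ↑P := by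
    rcases hcong (Set.range q) hK with ⟨A, hA⟩ | ⟨A, hA⟩
    · exact ⟨fccKissingPattern, Or.inr rfl, card_fccKissingPattern, A, hA⟩
    · exact ⟨hcpKissingPattern, Or.inl rfl, card_hcpKissingPattern, A, hA⟩
  -- enumerate the pattern along q
  have hmem : ∀ i, ∃ u ∈ P, q i = (2 : ℝ) • A u := by
    intro i
    have : q i ∈ (fun u => (2 : ℝ) • A u) '' ↑P := by
      rw [← hA]; exact Set.mem_range_self i
    obtain ⟨u, hu, hqu⟩ := this
    exact ⟨u, hu, hqu.symm⟩
  choose u huP hqu using hmem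
  have huinj : Function.Injective u := by
    intro i i' h
    apply hqinj
    rw [hqu i, hqu i', h]
  have huP' : Finset.univ.image u = P := by
    apply Finset.eq_of_subset_of_card_le
    · intro x hx
      obtain ⟨i, -, rfl⟩ := Finset.mem_image.1 hx
      exact huP i
    · rw [Finset.card_image_of_injective _ huinj, Finset.card_univ, Fintype.card_fin, hPcard]
  -- the 5d/4-shell of k is exactly the near set (the annular gap, δ ≤ 1/2000)
  have hshell : (Finset.univ.filter fun j' => j' ≠ k ∧ dist (y j') (y k) ≤ 5 * d / 4)
      = (Finset.univ.filter fun l => l ≠ k ∧ dist (y l) (y k) ≤ (1 + δ) * d) := by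
    ext m
    simp only [Finset.mem_filter, Finset.mem_univ, true_and]
    constructor
    · rintro ⟨hmk, hmd⟩
      refine ⟨hmk, ?_⟩
      rcases hdichk m hmk with h | h
      · exact h
      · exfalso
        have : (63 / 50 - 12 * δ) * d ≤ 5 * d / 4 := h.trans hmd
        nlinarith
    · rintro ⟨hmk, hmd⟩
      exact ⟨hmk, hmd.trans (by nlinarith)⟩
  have hSl : (Finset.univ.filter fun l => l ≠ k ∧ dist (y l) (y k) ≤ (1 + δ) * d) = Finset.univ.image (fun i : Fin 12 => (l i : Fin N)) := by
    apply Finset.coe_injective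
    rw [Finset.coe_image, Finset.coe_univ, Set.image_univ, hlrange]
  have hT_eq : ((Finset.univ.filter fun j' => j' ≠ k ∧ dist (y j') (y k) ≤ 5 * d / 4).image
      fun j' => y j' - y k) = Finset.univ.image (fun i : Fin 12 => y (l i) - y k) := by
    rw [hshell, hSl, Finset.image_image]
    rfl
  -- the matching
  have hmatch : EtaMatched (1 / 100) (Finset.univ.image (fun i : Fin 12 => y (l i) - y k))
      (Finset.univ.image (fun i : Fin 12 => A (d • u i))) := by
    apply etaMatched_of_tuples
    · intro i i' h
      dsimp only at h
      by_contra hne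
      have hne' : l i ≠ l i' := fun h' => hne (l.injective h')
      have hsep' := hsep (l i) (l i') hne' (hl6 i) (hl6 i')
      have h0 : dist (y (l i)) (y (l i')) = 0 := by
        rw [dist_eq_zero]; exact sub_left_injective h
      linarith
    · intro i i' h
      dsimp only at h
      exact huinj (smul_right_injective _ hd.ne' (A.injective h))
    · intro i
      have e1 : y (l i) - y k = (d / 2) • p i := by
        rw [hpdef, smul_smul, show d / 2 * (2 / d) = 1 by field_simp, one_smul]
      have e2 : A (d • u i) = (d / 2) • q i := by
        rw [A.map_smul, hqu i, smul_smul]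
        congr 1
        ring
      rw [e1, e2, dist_smul₀, Real.norm_eq_abs, abs_of_pos (by positivity)]
      calc d / 2 * dist (p i) (q i) ≤ d / 2 * (1 / 60) := by gcongr; exact hclose i
        _ ≤ 1 / 100 := by nlinarith
  -- conclude: Good (1/100) y k with a := d, t := 0
  have hfun : (fun w : EuclideanSpace ℝ (Fin 3) => d • (w + ((0 : ℝ) * (w 0 + w 1 + w 2) / 3) •
      Literature.Geometry.DiscreteGeometry.intVec ![1, 1, 1])) = fun w => d • w := by
    funext w
    simp
  have hSC : ShellCloseTo (1 / 100)
      ((Finset.univ.filter fun j' => j' ≠ k ∧ dist (y j') (y k) ≤ 5 * d / 4).image fun j' => y j' - y k)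
      (P.image fun w => d • (w + ((0 : ℝ) * (w 0 + w 1 + w 2) / 3) •
        Literature.Geometry.DiscreteGeometry.intVec ![1, 1, 1])) := by
    rw [hT_eq, hfun]
    refine ⟨A, ?_⟩
    have himg : (P.image fun w => d • w).image A = Finset.univ.image (fun i : Fin 12 => A (d • u i)) := by
      rw [← huP', Finset.image_image, Finset.image_image]
      rfl
    rw [himg]
    exact hmatch
  refine ⟨d, 0, hd1, by linarith, by norm_num, ?_⟩
  rcases hP with rfl | rfl
  · exact Or.inl hSC
  · exact Or.inr hSC

end Summit.AtomisticToContinuum.Crystallization.Theorems.ContactSaturationLadderTightSomewhereRungRigidity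

namespace Summit.AtomisticToContinuum.Crystallization.Theorems.ContactSaturationLadderTightSomewhereRungRigidity

open Summit.AtomisticToContinuum.Crystallization.Theorems.ContactSaturationLadderQuasiTwelve

/-! ## §F  The composition into the tree item -/

/-- Monotonicity of uniform tightness in the slack `δ`. -/
theorem uniformlyTight_mono {δ δ' d : ℝ} (hδ : δ ≤ δ') {N : ℕ} {y : Fin N → EuclideanSpace ℝ (Fin 3)} {j : Fin N}
    (h : (3 / 4 ≤ d ∧ d ≤ 6 / 5 ∧ (∀ k l : Fin N, k ≠ l → dist (y k) (y j) ≤ 6 → dist (y l) (y j) ≤ 6 → d ≤ dist (y k) (y l)) ∧ (∀ k : Fin N, dist (y k) (y j) ≤ 5 → 12 ≤ (Finset.univ.filter fun l => l ≠ k ∧ dist (y l) (y k) ≤ (1 + δ) * d).card))) :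
    (3 / 4 ≤ d ∧ d ≤ 6 / 5 ∧ (∀ k l : Fin N, k ≠ l → dist (y k) (y j) ≤ 6 → dist (y l) (y j) ≤ 6 → d ≤ dist (y k) (y l)) ∧ (∀ k : Fin N, dist (y k) (y j) ≤ 5 → 12 ≤ (Finset.univ.filter fun l => l ≠ k ∧ dist (y l) (y k) ≤ (1 + δ') * d).card)) := by
  obtain ⟨hd1, hd2, hsep, hcoord⟩ := h
  refine ⟨hd1, hd2, hsep, fun k hk => le_trans (hcoord k hk) (Finset.card_le_card ?_)⟩
  intro l hl
  simp only [Finset.mem_filter, Finset.mem_univ, true_and] at hl ⊢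
  refine ⟨hl.1, le_trans hl.2 ?_⟩
  have hd0 : 0 ≤ d := le_trans (by norm_num) hd1
  nlinarith

/-- The skeleton's composition (verbatim `TightSomewhereRung_of` of `TightSomewhereRung_birth.lean`), against the TREE
item: the facts and the door give `T` — its class is empty (δ := min δ₀ 3/50; frequently-tight ∧ eventually-defect-dense
⇒ some `N` with a uniformly tight 5-ball whose centre 2-ball holds a 1/100-bad particle, contradicting the door). -/
theorem TightSomewhereRung_of
    (hfacts : Literature.Geometry.DiscreteGeometry.flyspeck_L12 ∧ Literature.Geometry.DiscreteGeometry.Hales2012_kissingConfigCongruent)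
    (hrig : Literature.Geometry.DiscreteGeometry.flyspeck_L12 → Literature.Geometry.DiscreteGeometry.Hales2012_kissingConfigCongruent → ∃ δ₀ : ℝ, 0 < δ₀ ∧ ∀ (N : ℕ) (y : Fin N → EuclideanSpace ℝ (Fin 3)) (j : Fin N) (d : ℝ), (3 / 4 ≤ d ∧ d ≤ 6 / 5 ∧ (∀ k l : Fin N, k ≠ l → dist (y k) (y j) ≤ 6 → dist (y l) (y j) ≤ 6 → d ≤ dist (y k) (y l)) ∧ (∀ k : Fin N, dist (y k) (y j) ≤ 5 → 12 ≤ (Finset.univ.filter fun l => l ≠ k ∧ dist (y l) (y k) ≤ (1 + δ₀) * d).card)) → ∀ k : Fin N, dist (y k) (y j) ≤ 2 → (∃ a t : ℝ, 3 / 4 ≤ a ∧ a ≤ 3 / 2 ∧ |t| ≤ 1 / 100 ∧ (Literature.Geometry.DiscreteGeometry.ShellCloseTo (1 / 100) ((Finset.univ.filter fun j => j ≠ k ∧ dist (y j) (y k) ≤ 5 * a / 4).image fun j => y j - y k) (Literature.Geometry.DiscreteGeometry.hcpKissingPattern.image fun u => a • (u + (t * (u 0 + u 1 + u 2) / 3)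 • Literature.Geometry.DiscreteGeometry.intVec ![1, 1, 1])) ∨ Literature.Geometry.DiscreteGeometry.ShellCloseTo (1 / 100) ((Finset.univ.filter fun j => j ≠ k ∧ dist (y j) (y k) ≤ 5 * a / 4).image fun j => y j - y k) (Literature.Geometry.DiscreteGeometry.fccKissingPattern.image fun u => a • (u + (t * (u 0 + u 1 + u 2) / 3) • Literature.Geometry.DiscreteGeometry.intVec ![1, 1, 1]))))) :
    Summit.AtomisticToContinuum.Crystallization.Theses.ContactSaturationLadder.TightSomewhereRung := by
  unfold Summit.AtomisticToContinuum.Crystallization.Theses.ContactSaturationLadder.TightSomewhereRung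
  obtain ⟨δ₀, hδ₀, hR⟩ := hrig hfacts.1 hfacts.2
  refine ⟨min δ₀ (3 / 50), lt_min hδ₀ (by norm_num), min_le_right _ _, ?_⟩
  intro x _ hdd _ _ _ _ _ htight
  exfalso
  obtain ⟨N, ⟨j, d, hT⟩, hD⟩ := (htight.and_eventually hdd).exists
  obtain ⟨k, hk, hbad⟩ := hD j
  exact hbad (hR N (x N) j d (uniformlyTight_mono (min_le_left _ _) hT) k hk)

/-- **`T` from the two vendored named facts** (tree item `ContactSaturationLadder.TightSomewhereRung`, by name; the
only hypotheses are the cited facts `flyspeck_L12` and `Hales2012_kissingConfigCongruent`). -/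
theorem tightSomewhereRung_of_facts
    (hL12 : Literature.Geometry.DiscreteGeometry.flyspeck_L12)
    (hcong : Literature.Geometry.DiscreteGeometry.Hales2012_kissingConfigCongruent) :
    Summit.AtomisticToContinuum.Crystallization.Theses.ContactSaturationLadder.TightSomewhereRung :=
  TightSomewhereRung_of ⟨hL12, hcong⟩ stub_rigidityFromFlyspeck

end Summit.AtomisticToContinuum.Crystallization.Theorems.ContactSaturationLadderTightSomewhereRungRigidity
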